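import Summits.BirchSwinnertonDyer.Rank1Residual.X11b.IntSeriesValueRigidityOneSided
import Summits.BirchSwinnertonDyer.BirchSwinnertonDyer.Theorems.CongruentShaFreeCutCharacterSupply
import HarnessLib

set_option linter.dupNamespace false -- `…BirchSwinnertonDyer.BirchSwinnertonDyer…` is the cell's namespace (D-0017)
set_option autoImplicit false

/-!
# Crux `PrintCf2.SplitBadTwoRankOneOfFacts` (item 20368), line `eisenstein_two_bdp_line` — VALUE TRANSFER AT `𝟙` for EVERY prime
# (so at `p = 2`): a continuous display of Castella's interpolation values at the trivial character pins `Q(𝟙)` for EVERY ♭-frame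

Lead `bsd-line-cf2-p1` g5 (prover), cell `bsd-print-cf2`, 2026-08-28; `--supports stmt-BirchSwinnertonDyer-20368` (helper of the
registered line `eisenstein_two_bdp_line`, skeleton d31d09cefdf06587; closes nothing). ONE THEOREM (no definition, no named fact, no
`sorry`). HONEST FRAMING: this is the TRANSFER half of the critic's D2b («LZZ constant bookkeeping at 2», idea-crit-10 VERDICT #19 P2):
it removes the `p ≠ 2` of X11b's one-sided value rigidity `X11b.intSeries_constantCoeff_eq_of_isBDPLFunctionInt_of_continuousValues`
— whose parity entered only through the interpolation supply `X11b.exists_interpolationSupply_pow` — by feeding cell bsd-cn100's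
any-prime supply `…Theorems.CongruentShaFreeCutCharacterSupply.characterSupplyAt` (p442134) into X11b's supply-explicit kernel
`X11b.intSeries_constantCoeff_eq_of_isBDPLFunctionInt_of_tendsto`. What REMAINS of D2b at `p = 2` is the DISPLAY: the continuity at
`𝟙` of the Liu–Zhang–Zhang values with the constants `2^{1−2n}`, `(2/h_K)²`, `w_K = 2`, `c²` tracked as an explicit power of `2` (the
odd-`p` display `UniversalToricDescentWaldspurgerFlat.exists_continuousDisplay_manin` treats them as units, `hp2`). Nothing here
constructs a frame, displays a value or says anything about BSD.

* `intSeries_constantCoeff_eq_of_isBDPLFunctionInt_of_continuousValues_anyPrime` — `K` imaginary quadratic, `κ` anticyclotomic with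
  topological generator `γ`, ANY prime `p`: if the would-be interpolation values `ι⁻¹(bdpInterpolationValue p f 𝔭 φ n Ω_K)·Ω_p^{4n}`
  of a virtual frame `(Ω_K, Ω_p)` (non-zero periods) tend to `c ≠ 0` along EVERY interpolation sequence `(φ_k, n_k, r_k)` with
  `r_k(γ) → 1`, then every ♭-frame `(Ω_K', Ω_p', Q')` of the same `(ι, 𝔭, κ, γ, f)` has `[T⁰]Q' = c`.

References: Castella 2018 Thm. 3.1–3.2 (arXiv:1704.06608 pp. 8–9) (shapes); Castella–Hsieh 2018 §3.3; Liu–Zhang–Zhang, Duke Math. J.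
167 (2018) Thm 1.5.1/1.5.3 (the display to be supplied at 2). BSD is not proved by any of this.
-/

noncomputable section

open scoped Classical Topology NumberField
open Filter NumberField IsDedekindDomain Field PowerSeries
open Literature.NumberTheory.EllipticCurves Literature.NumberTheory.GaloisRepresentations
open Summit.BirchSwinnertonDyer.Rank1Residual.X11b

namespace Summit.BirchSwinnertonDyer.BirchSwinnertonDyer.Theorems.PrintCf2

variable {p : ℕ} [Fact p.Prime] {K : Type} [Field K] [NumberField K] {N : ℕ}

/-- **One-sided ♭-value rigidity against a CONTINUOUS value assignment, at EVERY prime `p` (incl. `2`).** For `K` imaginary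
quadratic, `κ` anticyclotomic with topological generator `γ`: if the would-be interpolation values
`ι⁻¹(bdpInterpolationValue p f 𝔭 φ n Ω_K)·Ω_p^{4n}` of the virtual frame `(Ω_K, Ω_p)` (non-zero periods) tend to `c ≠ 0` along EVERY
interpolation sequence `(φ_k, n_k, r_k)` with `r_k(γ) → 1`, then every ♭-frame `(Ω_K', Ω_p', Q')` of the same `(ι, 𝔭, κ, γ, f)` has
`[T⁰]Q' = c`. X11b's `…_of_continuousValues` with its odd-prime supply replaced by bsd-cn100's any-prime `characterSupplyAt`.
[cite: Castella2018, Thm. 3.1–3.2 (arXiv:1704.06608 pp. 8–9)] -/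
theorem intSeries_constantCoeff_eq_of_isBDPLFunctionInt_of_continuousValues_anyPrime
    {ι : PadicAlgCl p ≃+* ℂ} {𝔭 : HeightOneSpectrum (𝓞 K)} {κ : ZpExtension K p}
    {γ : Field.absoluteGaloisGroup K} {f : CuspForm (CongruenceSubgroup.Gamma0 N) 2}
    {ΩK ΩK' : ℂ} {Ωp Ωp' : ℂ_[p]} {Q' : PowerSeries 𝓞_ℂ_[p]} {c : ℂ_[p]}
    (hK : IsImaginaryQuadratic K) (hκ : κ.IsAnticyclotomic) (hγ : κ.IsTopGenerator γ)
    (hΩK : ΩK ≠ 0) (hΩK' : ΩK' ≠ 0) (hΩp : Ωp ≠ 0) (hΩp' : Ωp' ≠ 0)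
    (hcont : ∀ (φ : ℕ → HeckeCharacter K) (n : ℕ → ℕ) (r : ℕ → FramedGaloisRep K (PadicAlgCl p) 1),
      (∀ k, 0 < n k) → (∀ k (v : HeightOneSpectrum (𝓞 K)), (φ k).IsUnramifiedAt v) →
      (∀ k, (φ k).HasInfinityType (fun _ ↦ (n k : ℤ)) (fun _ ↦ -(n k : ℤ))) →
      (∀ k, IsPAdicAvatarOf ι (φ k) (r k)) → (∀ k, FactorsThroughZp κ (r k)) →
      Tendsto (fun k ↦ avatarValueAt (r k) γ) atTop (𝓝 1) →
      Tendsto (fun k ↦ ((ι.symm (bdpInterpolationValue p f 𝔭 (φ k) (n k) ΩK) : PadicAlgCl p) :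
        ℂ_[p]) * Ωp ^ (4 * n k)) atTop (𝓝 c))
    (hc : c ≠ 0) (hQ' : R1.IsBDPLFunctionInt p ι 𝔭 κ γ f ΩK' Ωp' Q') :
    ((constantCoeff Q' : 𝓞_ℂ_[p]) : ℂ_[p]) = c := by
  have hp : p.Prime := Fact.out
  obtain ⟨m, x₀, φ, φ', r, r', hm, -, hx, hunr, hinf, hr, hrκ, hval, hunr', hinf', hr', hrκ', hval'⟩ :=
    Summit.BirchSwinnertonDyer.BirchSwinnertonDyer.Theorems.CongruentShaFreeCutCharacterSupply.characterSupplyAt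
      (p := p) K ι κ γ hK hκ hγ
  have hn : ∀ k, 0 < m * p ^ k := fun k ↦ Nat.mul_pos hm (pow_pos hp.pos k)
  have hn' : ∀ k, 0 < 2 * m * p ^ k := fun k ↦ Nat.mul_pos (Nat.mul_pos two_pos hm) (pow_pos hp.pos k)
  have hlim : Tendsto (fun k ↦ avatarValueAt (r k) γ) atTop (𝓝 1) := by
    simp_rw [hval]; exact hx
  have hlim' : Tendsto (fun k ↦ avatarValueAt (r' k) γ) atTop (𝓝 1) := by
    simp_rw [hval']
    have h2 : Tendsto (fun k ↦ (x₀ ^ p ^ k) ^ 2) atTop (𝓝 1) := by simpa using hx.pow 2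
    refine h2.congr fun k ↦ ?_
    ring
  have hv := hcont (fun k ↦ φ k) (fun k ↦ m * p ^ k) r hn hunr hinf hr hrκ hlim
  have hw := hcont (fun k ↦ φ' k) (fun k ↦ 2 * m * p ^ k) r' hn' hunr' hinf' hr' hrκ' hlim'
  exact intSeries_constantCoeff_eq_of_isBDPLFunctionInt_of_tendsto K N ι 𝔭 κ γ f ΩK ΩK' Ωp Ωp' Q' m x₀
    φ φ' r r' c hm hx hunr hinf hr hrκ hval hunr' hinf' hr' hrκ' hval' hΩK hΩK' hΩp hΩp' hv hw hc hQ'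

end Summit.BirchSwinnertonDyer.BirchSwinnertonDyer.Theorems.PrintCf2
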